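import Literature.Probability.Percolation.ArmExponents
import Literature.Probability.Percolation.ArmEventsProofs
import Mathlib.Analysis.SpecialFunctions.Log.Basic
import Mathlib.Analysis.SpecificLimits.Basic
import Mathlib.Data.Nat.Log
import HarnessLib

/-!
# The two-arm exponent `1/4`: Smirnov–Werner's proof architecture as named facts + assembly

Family: crit-perc (trunk StatMech). This file serves the discharge of the named fact
`Literature.Probability.Percolation.twoArm_exponent` (`ArmExponents.lean`; Smirnov–Werner, *Critical exponents for
two-dimensional percolation*, Math. Res. Lett. 8 (2001), 729–744, Thm. 4 of the arXiv text
(`math/0109120`, "plane exponents", `j = 2`; equation numbers below are those of the arXiv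
text): for critical site percolation on `𝕋` and every large enough `r₀`,
`P_{1/2}(armEvent ![true,false] r₀ R) = R^{-1/4 + o(1)}`).

Smirnov–Werner (§4, p. 7: "Exactly as its half-plane counterpart, the theorem follows from the
two observations") reduce Thm. 4 to two inputs, and Nolin (*Near-critical percolation in two
dimensions*, Electron. J. Probab. 13 (2008), Thm. 21 (Thm. 20 of the arXiv text), proof sketch)
phrases the same reduction directly for the arm probabilities `b(r, R) = P_{1/2}(armEvent κ r R)`:

* **(A) scaling limit with the `SLE₆` exponent** (`SmirnovWerner2001_twoArm_scalingLimit`):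
  `b'(R/r) := lim_{ρ → ∞} b(ρ r, ρ R)` exists (Smirnov's conformally invariant scaling limit,
  SW (16)) and `b'(λ) = λ^{-1/4 + o(1)}` as `λ → ∞` (SW (9) via (12), (13), (15): the
  disconnection exponent of radial/chordal `SLE₆`, Lawler–Schramm–Werner; Nolin, proof of
  Thm. 21: "`P_{1/2}(A_{j,σ}(η n, n)) → g_j(η)` for some function `g_j(η) ∼ η^{α_j}`").
  This is a theory (Smirnov's theorem + `SLE₆` computations) and stays a named fact.
* **(B) quasi-multiplicativity** (`Nolin2008_twoArm_quasiMult`):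
  `b(n₁, n₃) ≥ c · b(n₁, n₂) · b(n₂, n₃)` (SW (10), right half, and §4.2; Kesten 1987; in the
  clean general form Nolin 2008, Prop. 17). Arm-separation theory; stays a named fact.
* **(C) sub-multiplicativity** (`Literature.Probability.Percolation.polyArmProb_submult`, PROVED in
  `ArmEventsProofs.lean`, general colour sequences): `b(n₁, n₃) ≤ b(n₁, n₂) · b(n₂ + 1, n₃)`,
  by truncation of arms and independence of disjoint annuli (SW §4.2, first display of the
  proof of (10); Nolin Prop. 17, upper half).
* **(D) monotonicity in the outer radius** (`Literature.Probability.Percolation.polyArmProb_anti_holds`, PROVED in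
  `ArmEventsProofs.lean`, discharging the named fact `polyArmProb_anti` of `ArmEvents.lean`;
  SW §3, "as `a_j(r, R)` is decreasing in `R`").
* **(E) positivity** (`Literature.Probability.Percolation.polyArmProb_twoArm_pos`, PROVED in `ArmEventsProofs.lean`):
  `b(r, R) > 0` for `1 ≤ r ≤ R` (Nolin §4.1, `n₀(j)`: two explicit disjoint rays, a cylinder
  event of finitely many sites).

From the named facts (A), (B) and the theorems (C)–(E) this file PROVES `twoArm_exponent`
(`twoArm_exponent_of_facts : (A) → (B) → twoArm_exponent`), following the product-of-scales
argument printed by Smirnov–Werner for the half-plane case (p. 5, proof of Thm. 3 from (3) and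
(4): choose a large ratio `K`, chain the annuli `Λ_{K^{m+1}} \ Λ_{K^m}`, and sandwich a
general `R` between consecutive powers of `K`; here `Nat.log K R` locates `R`). The lower bound
chains (B) along the scales `K^m` with the limit `b(σ, Kσ) → b'(K)`; the upper bound chains
(C)+(D) along `b(2K^m, K^{m+1})` with the limit `b(2σ, Kσ) → b'(K/2)`; (E) makes all
logarithms honest (`Real.log 0 = 0` would otherwise be a junk value). What remains for an
unconditional `twoArm_exponent_holds` is exactly Smirnov–Werner's two observations (A), (B).

Faithfulness notes.
* Shapes. SW work with annuli bounded by discretised circles and note (p. 5) "One could as well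
  take a semi-hexagonal or a triangular shape instead of the semi-circles"; Nolin works with
  rhombi `S_n`. Here, as everywhere in this library, the annuli are the lattice hexagons
  `Λ_R \ Λ_r` of `armEvent` (`Λ_n = triBall n`, the graph ball). All these shapes are nested
  within constant multiples of the radii, which is invisible in `o(1)`-exponent statements and
  in `≍`-statements such as (B) (Nolin, Prop. 16, extendability).
* For `j = 2` the colour sequence `![true, false]` (one open, one closed arm) is the only
  polychromatic one and the cyclic order of two arms is vacuous, so SW's `b_2` ("two disjoint
  crossings not all of the same colour") is exactly `polyArmProb ![true, false]`.
* SW print (9) for the exploration-process crossing probabilities `b_j^{ep}`; for even `j`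
  (here `j = 2`) `b_j^{ep} ≍ b_j` (SW (15) and the sentence following it), and multiplicative
  constants do not affect the exponent, so (A) records (9) for `b_2` itself, exactly as in
  Nolin's sketch.
* (B) is recorded with an unspecified threshold `n₀` (Nolin: `n₀(j) ≤ j`, explicit) and an
  unspecified constant `c > 0`, at `p = 1/2` only (Nolin: uniformly for `p` near `1/2` below the
  characteristic length `L(p)`, `L(1/2) = ∞`); this is weaker than, and implied by, the source.
* Numbering. Smirnov–Werner's theorem and equation numbers are those of the arXiv text
  `math/0109120` (as declared above). Nolin's items are numbered as in the published EJP
  version, following `KestenScaling.lean` and the citing literature: Prop. 16 (extendability),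
  Prop. 17 (quasi-multiplicativity), Thm. 21 (arm exponents in the plane at `p = 1/2`) — so
  cited by van den Berg–Nolin (arXiv:1512.05335, §2.2 (iii): "Propositions 16 and 17") and by
  van den Berg–Conijn (Electron. Commun. Probab. 21 (2016), §2, for their arm-event bounds:
  "Theorems 21 and 22 in [Nol08]" in the published text, "Theorem 11, Proposition 14 and
  Theorem 24" in arXiv:1505.08046); the arXiv preprint 0711.4948, whose text we have read,
  numbers these Prop. 15, Prop. 16, Thm. 20 (in every instance checked — its Thm. 10,
  Prop. 13, Props. 15–16, Thms. 20–21, Thm. 23 — the EJP number is the arXiv number plus one,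
  with matching item types). Nolin's sections (§4.1, §4.3–4.5, §5.1) are those of the arXiv
  text.

Mathlib search: no percolation / arm events / `SLE` in Mathlib (`rg -i "percolation|arm
event|SLE"` finds nothing relevant); `Nat.log`, `Real.log`, `Filter.Tendsto` API from Mathlib.
This file introduces the abbreviation `critTwoArmProb`, two `Prop`-valued named facts and the
proved assembly; the helper lemmas of the assembly live in the namespace
`Literature.CritPerc.TwoArmAssembly`. `critTwoArmProb` is the companion of `critOneArmProb` and
`critFourArmProb` of `KestenScaling.lean`; it is declared here rather than next to them because
this file, not `KestenScaling.lean`, imports the proofs module `ArmEventsProofs.lean` it is used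
with, and `KestenScaling.lean` (near-critical scaling) is not an import of the two-arm assembly.
-/

noncomputable section

open Filter Topology MeasureTheory
open scoped ENNReal

namespace Literature.Probability.Percolation

open LatticeModels

/-- The critical polychromatic two-arm probability
`π₂(r, R) = b_2(r, R) = P_{1/2}(armEvent ![true, false] r R)` on `𝕋` (one open and one closed
arm, vertex-disjoint, across `Λ_R ∖ Λ_r`), the sequence in `R` whose exponent `1/4` is
`twoArm_exponent`; companion of `critOneArmProb`, `critFourArmProb` (`KestenScaling.lean`). (Smirnov–Werner 2001,
§4, `b_j(r, R)` with `j = 2`; Nolin 2008, §5.1, `π_j(n|N)`.) [cite: SmirnovWernerMRL2001, §4 (definition of b_j(r,R))] [cite: Nolin2008, §5.1 (definition of π_j(n|N))] -/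
abbrev critTwoArmProb (r R : ℕ) : ℝ := polyArmProb ![true, false] r R

/-- **Scaling limit of the two-arm probability and its `SLE₆` exponent** (Smirnov–Werner 2001,
§4: (16) "It follows from [Smirnov 2001] that `b_j(ρ r, ρ R)` has a scaling limit, which is
conformally invariant, and so depends on the ratio `R/r` only: `b'_j(R/r) = lim_ρ b_j(ρ r, ρ R)`",
together with (9) `lim_ρ b_j^{ep}(ρ, R ρ) = R^{-(j²-1)/12 + o(1)}` when `R → ∞` (from (12), the
convergence of the exploration process to `SLE₆`, and (13), the `SLE₆` exponents of
Lawler–Schramm–Werner), specialised to `j = 2`, where `(j² - 1)/12 = 1/4` and `b_2^{ep} ≍ b_2`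
((15) and the sentence following it, even `j`), so that `b'_2(λ) = λ^{-1/4 + o(1)}`; Nolin 2008,
proof sketch of Thm. 21 [arXiv 0711.4948: Thm. 20]: "`P_{1/2}(A_{j,σ}(η n, n)) → g_j(η)` for some function
`g_j(η) ∼ η^{α_j}` as `η → 0`", `α_2 = 1/4`). In Lean: there is `b' : ℝ → ℝ` such that for all
integers `1 ≤ r < R` the two-arm probabilities of the annuli `Λ_{ρR} \ Λ_{ρr}` converge to
`b'(R/r)` as `ρ → ∞` (`ρ ∈ ℕ`), and `log b'(λ) / log λ → -1/4` as `λ → ∞` (the `o(1)`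
exponent, as in `HasDecayExponent`). Hexagonal annuli replace SW's discretised circular ones
(SW p. 5: "One could as well take a semi-hexagonal or a triangular shape"): the scaling limit
exists for them by the same theorem of Smirnov, and although the limit function `b'` of the
hexagonal annuli differs from the circular one, it obeys the same exponent, hexagonal and
circular annuli being nested within constant factors of the radii. This is the deep input
(Smirnov's theorem and the `SLE₆` disconnection exponent). [cite: SmirnovWernerMRL2001, §4 (9), (15), (16)] [cite: Nolin2008, Thm. 21 (proof sketch) (arXiv 0711.4948: Thm. 20)] -/
def SmirnovWerner2001_twoArm_scalingLimit : Prop :=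
  ∃ b' : ℝ → ℝ,
    (∀ r R : ℕ, 1 ≤ r → r < R →
      Tendsto (fun ρ : ℕ => critTwoArmProb (ρ * r) (ρ * R)) atTop (𝓝 (b' ((R : ℝ) / r)))) ∧
    Tendsto (fun l : ℝ => Real.log (b' l) / Real.log l) atTop (𝓝 (-(1 / 4)))

/-- **Quasi-multiplicativity of the two-arm probability** (Nolin 2008, Prop. 17 [arXiv
0711.4948: Prop. 16], lower half,
for `P = P_{1/2}`, `j = 2`, `σ = (black, white)`, where `L(1/2) = ∞`:
`P(A_{j,σ}(n₁, n₂)) · P(A_{j,σ}(n₂, n₃)) ≍ P(A_{j,σ}(n₁, n₃))` uniformly in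
`n₀(j) ≤ n₁ < n₂ < n₃`; Smirnov–Werner 2001, (10), right half, and §4.2 (after Kesten 1987 and
Kesten–Sidoravicius–Zhang) is the version along the radii `R^l` used there). In Lean: there are
`c > 0` and a threshold `n₀` such that
`c · P_{1/2}(armEvent κ n₁ n₂) · P_{1/2}(armEvent κ n₂ n₃) ≤ P_{1/2}(armEvent κ n₁ n₃)` for all
`n₀ ≤ n₁ < n₂ < n₃`, `κ = ![true, false]`. Recorded with an unspecified threshold and constant
(Nolin's `n₀(2)` is explicit) and for the hexagonal annuli of `armEvent` (Nolin's `S_n` are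
rhombi; the transfer costs constant factors in the radii, absorbed by extendability, Nolin
Prop. 16). This is arm-separation theory (Nolin §4.3–4.5) and stays a named fact here.
[cite: Nolin2008, Prop. 17 (arXiv 0711.4948: Prop. 16)] [cite: SmirnovWernerMRL2001, §4 (10) and §4.2] -/
def Nolin2008_twoArm_quasiMult : Prop :=
  ∃ c : ℝ, 0 < c ∧ ∃ n₀ : ℕ, ∀ n₁ n₂ n₃ : ℕ, n₀ ≤ n₁ → n₁ < n₂ → n₂ < n₃ →
    c * (critTwoArmProb n₁ n₂ * critTwoArmProb n₂ n₃) ≤ critTwoArmProb n₁ n₃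

/-! ### The assembly (Smirnov–Werner 2001, p. 5, proof of Thm. 3 from (3)–(4), run for Thm. 4) -/

namespace TwoArmAssembly

/-- Dividing a nonpositive number by a larger positive number increases it. [folklore] -/
theorem div_le_div_of_nonpos_left' {c x y : ℝ} (hc : c ≤ 0) (hx : 0 < x) (hxy : x ≤ y) :
    c / x ≤ c / y := by
  rw [div_le_div_iff₀ hx (lt_of_lt_of_le hx hxy)]
  exact mul_le_mul_of_nonpos_left hxy hc

/-- `(α d + β) / (γ d + δ) → α / γ` as `d → ∞` (`γ ≠ 0`). [folklore] -/
theorem tendsto_affine_div_affine (α β γ δ : ℝ) (hγ : γ ≠ 0) :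
    Tendsto (fun d : ℕ => (α * d + β) / (γ * d + δ)) atTop (𝓝 (α / γ)) := by
  have h1 : Tendsto (fun d : ℕ => α + β / (d : ℝ)) atTop (𝓝 α) := by
    simpa using tendsto_const_nhds.add (tendsto_const_div_atTop_nhds_zero_nat β)
  have h2 : Tendsto (fun d : ℕ => γ + δ / (d : ℝ)) atTop (𝓝 γ) := by
    simpa using tendsto_const_nhds.add (tendsto_const_div_atTop_nhds_zero_nat δ)
  refine (h1.div h2 hγ).congr' ?_
  filter_upwards [eventually_ge_atTop 1] with d hd
  have hd' : (0 : ℝ) < d := by exact_mod_cast hd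
  simp only [Pi.div_apply]
  field_simp

/-- The upper chain: if `b(2K^m, K^{m+1}) ≤ U` for all `m ≥ j₀`, then
`b(2K^m, K^{m+1+d}) ≤ U^{d+1}` (sub-multiplicativity (C) and monotonicity (D) along the scales
`K^m`; Smirnov–Werner 2001, p. 5 and §4.2). [cite: SmirnovWernerMRL2001, §4.2 proof of (10)] -/
theorem upper_chain {K j₀ : ℕ} (hK : 2 ≤ K)
    {U : ℝ} (hU0 : 0 ≤ U) (hU : ∀ m, j₀ ≤ m → critTwoArmProb (2 * K ^ m) (K ^ (m + 1)) ≤ U) :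
    ∀ d m n : ℕ, j₀ ≤ m → n = m + 1 + d → critTwoArmProb (2 * K ^ m) (K ^ n) ≤ U ^ (d + 1) := by
  intro d
  induction d with
  | zero =>
    intro m n hm hn
    subst hn
    simpa using hU m hm
  | succ d ih =>
    intro m n hm hn
    subst hn
    have hlt : K ^ m < K ^ (m + 1) := Nat.pow_lt_pow_right (by omega) (by omega)
    have hKm1 : 2 * K ^ m ≤ K ^ (m + 1) := by
      calc 2 * K ^ m ≤ K * K ^ m := Nat.mul_le_mul_right _ hK
        _ = K ^ (m + 1) := by rw [pow_succ, mul_comm]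
    have hbig : 2 * K ^ (m + 1) ≤ K ^ (m + 1 + (d + 1)) := by
      calc 2 * K ^ (m + 1) ≤ K * K ^ (m + 1) := Nat.mul_le_mul_right _ hK
        _ = K ^ (m + 1 + 1) := by rw [pow_succ _ (m + 1), mul_comm]
        _ ≤ K ^ (m + 1 + (d + 1)) := Nat.pow_le_pow_right (by omega) (by omega)
    obtain ⟨n₂, hn₂⟩ : ∃ n₂, n₂ + 1 = 2 * K ^ (m + 1) := ⟨2 * K ^ (m + 1) - 1, by omega⟩
    have h12 : 2 * K ^ m ≤ n₂ := by omega
    have h23 : n₂ < K ^ (m + 1 + (d + 1)) := by omega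
    have step := polyArmProb_submult ![true, false] h12 h23
    rw [hn₂] at step
    have hanti : critTwoArmProb (2 * K ^ m) n₂ ≤ critTwoArmProb (2 * K ^ m) (K ^ (m + 1)) :=
      polyArmProb_anti_holds ![true, false] hKm1 (by omega)
    have ih' := ih (m + 1) (m + 1 + (d + 1)) (by omega) (by ring)
    calc critTwoArmProb (2 * K ^ m) (K ^ (m + 1 + (d + 1)))
        ≤ critTwoArmProb (2 * K ^ m) n₂ * critTwoArmProb (2 * K ^ (m + 1)) (K ^ (m + 1 + (d + 1))) := step
      _ ≤ U * U ^ (d + 1) :=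
          mul_le_mul (hanti.trans (hU m hm)) ih' (polyArmProb_nonneg _ _ _) hU0
      _ = U ^ (d + 1 + 1) := by ring

/-- The lower chain: if `L ≤ b(K^m, K^{m+1})` for all `m ≥ j₀`, then
`c^d L^{d+1} ≤ b(K^m, K^{m+1+d})` (quasi-multiplicativity (B) along the scales `K^m`;
Smirnov–Werner 2001, p. 5). [cite: SmirnovWernerMRL2001, §3 proof of Thm. 3 (p. 5)] -/
theorem lower_chain {c : ℝ} (hc : 0 ≤ c) {n₀ : ℕ}
    (hqm : ∀ n₁ n₂ n₃ : ℕ, n₀ ≤ n₁ → n₁ < n₂ → n₂ < n₃ → c * (critTwoArmProb n₁ n₂ * critTwoArmProb n₂ n₃) ≤ critTwoArmProb n₁ n₃)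
    {K j₀ : ℕ} (hK : 2 ≤ K) (hn₀ : ∀ m, j₀ ≤ m → n₀ ≤ K ^ m)
    {L : ℝ} (hL0 : 0 ≤ L) (hL : ∀ m, j₀ ≤ m → L ≤ critTwoArmProb (K ^ m) (K ^ (m + 1))) :
    ∀ d m n : ℕ, j₀ ≤ m → n = m + 1 + d → c ^ d * L ^ (d + 1) ≤ critTwoArmProb (K ^ m) (K ^ n) := by
  intro d
  induction d with
  | zero =>
    intro m n hm hn
    subst hn
    simpa using hL m hm
  | succ d ih =>
    intro m n hm hn
    subst hn
    have h12 : K ^ m < K ^ (m + 1) := Nat.pow_lt_pow_right (by omega) (by omega)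
    have h23 : K ^ (m + 1) < K ^ (m + 1 + (d + 1)) := Nat.pow_lt_pow_right (by omega) (by omega)
    have step := hqm _ _ _ (hn₀ m hm) h12 h23
    have ih' := ih (m + 1) (m + 1 + (d + 1)) (by omega) (by ring)
    calc c ^ (d + 1) * L ^ (d + 1 + 1) = c * (L * (c ^ d * L ^ (d + 1))) := by ring
      _ ≤ c * (critTwoArmProb (K ^ m) (K ^ (m + 1)) * critTwoArmProb (K ^ (m + 1)) (K ^ (m + 1 + (d + 1)))) := by
          apply mul_le_mul_of_nonneg_left _ hc
          exact mul_le_mul (hL m hm) ih' (mul_nonneg (pow_nonneg hc _) (pow_nonneg hL0 _))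
            (polyArmProb_nonneg _ _ _)
      _ ≤ critTwoArmProb (K ^ m) (K ^ (m + 1 + (d + 1))) := step

/-- Upper half of the exponent: from (A), (C), (D), (E), for every `a ∈ (-1/4, 0)` eventually
`log b(r₀, N) / log N < a` (Smirnov–Werner 2001, p. 5, upper product bound, with the sandwich
`K^n ≤ N < K^{n+1}`). [cite: SmirnovWernerMRL2001, §3 proof of Thm. 3 (p. 5) and §4] -/
theorem upper_part (b' : ℝ → ℝ)
    (hlim : ∀ r R : ℕ, 1 ≤ r → r < R →
      Tendsto (fun ρ : ℕ => critTwoArmProb (ρ * r) (ρ * R)) atTop (𝓝 (b' ((R : ℝ) / r))))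
    (hexp : Tendsto (fun l : ℝ => Real.log (b' l) / Real.log l) atTop (𝓝 (-(1 / 4))))
    {r₀ : ℕ} (hr₀ : 1 ≤ r₀) {a : ℝ} (ha : -(1 / 4) < a) (ha0 : a < 0) :
    ∀ᶠ N : ℕ in atTop, Real.log (critTwoArmProb r₀ N) / Real.log N < a := by
  -- an intermediate exponent `-1/4 < a' < a`
  set a' : ℝ := (a + -(1 / 4)) / 2 with ha'_def
  have ha'1 : -(1 / 4) < a' := by rw [ha'_def]; linarith
  have ha'2 : a' < a := by rw [ha'_def]; linarith
  have ha'0 : a' < 0 := by linarith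
  -- Step 1: the ratio `K`, through the limit exponent at `λ = K / 2`
  have hcast : Tendsto (fun K : ℕ => (K : ℝ) / 2) atTop atTop :=
    tendsto_natCast_atTop_atTop.atTop_div_const (by norm_num)
  have h1 : Tendsto (fun K : ℕ => Real.log (b' ((K : ℝ) / 2)) / Real.log ((K : ℝ) / 2)) atTop
      (𝓝 (-(1 / 4))) := hexp.comp hcast
  have hlogK : Tendsto (fun K : ℕ => Real.log (K : ℝ)) atTop atTop :=
    Real.tendsto_log_atTop.comp tendsto_natCast_atTop_atTop
  have h2 : Tendsto (fun K : ℕ => Real.log ((K : ℝ) / 2) / Real.log (K : ℝ)) atTop (𝓝 1) := by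
    have h : Tendsto (fun K : ℕ => 1 - Real.log 2 / Real.log (K : ℝ)) atTop (𝓝 (1 - 0)) :=
      tendsto_const_nhds.sub (tendsto_const_nhds.div_atTop hlogK)
    rw [sub_zero] at h
    refine h.congr' ?_
    filter_upwards [eventually_ge_atTop 2] with K hK
    have hK' : (2 : ℝ) ≤ K := by exact_mod_cast hK
    have hlog : Real.log (K : ℝ) ≠ 0 := ne_of_gt (Real.log_pos (by linarith))
    rw [Real.log_div (by positivity) (by norm_num)]
    field_simp
  have h3 : Tendsto (fun K : ℕ => Real.log (b' ((K : ℝ) / 2)) / Real.log (K : ℝ)) atTop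
      (𝓝 (-(1 / 4))) := by
    have h := h1.mul h2
    rw [mul_one] at h
    refine h.congr' ?_
    filter_upwards [eventually_ge_atTop 3] with K hK
    have hK' : (3 : ℝ) ≤ K := by exact_mod_cast hK
    have hlog : Real.log ((K : ℝ) / 2) ≠ 0 := ne_of_gt (Real.log_pos (by linarith))
    have hlog' : Real.log (K : ℝ) ≠ 0 := ne_of_gt (Real.log_pos (by linarith))
    field_simp
  have h4 : ∀ᶠ K : ℕ in atTop, Real.log (b' ((K : ℝ) / 2)) / Real.log (K : ℝ) < a' :=
    h3.eventually_lt_const ha'1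
  obtain ⟨K, hK4, hK3⟩ := (h4.and (eventually_ge_atTop 3)).exists
  have hK2 : 2 ≤ K := by omega
  have hK1 : 1 < K := by omega
  have hKR : (3 : ℝ) ≤ K := by exact_mod_cast hK3
  have hlogKpos : 0 < Real.log (K : ℝ) := Real.log_pos (by linarith)
  have hK4' : Real.log (b' ((K : ℝ) / 2)) < a' * Real.log K := (div_lt_iff₀ hlogKpos).1 hK4
  -- the per-scale bound `U = K^{a'}`
  set U : ℝ := Real.exp (a' * Real.log K) with hU_def
  have hU0 : 0 < U := Real.exp_pos _
  have hlogU : Real.log U = a' * Real.log K := Real.log_exp _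
  have hbU : b' ((K : ℝ) / 2) < U := by
    by_cases hb : b' ((K : ℝ) / 2) ≤ 0
    · exact lt_of_le_of_lt hb hU0
    · rw [← Real.log_lt_log_iff (lt_of_not_ge hb) hU0, hlogU]
      exact hK4'
  -- Step 2: the scale beyond which `b(2σ, Kσ) < U`
  have h5 : ∀ᶠ ρ : ℕ in atTop, critTwoArmProb (ρ * 2) (ρ * K) < U := by
    have h : Tendsto (fun ρ : ℕ => critTwoArmProb (ρ * 2) (ρ * K)) atTop (𝓝 (b' ((K : ℝ) / 2))) := by
      simpa using hlim 2 K (by norm_num) (by omega)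
    exact h.eventually_lt_const hbU
  obtain ⟨σ₀, hσ₀⟩ := eventually_atTop.1 h5
  -- Step 3: the first scale `K^{j₀}`
  set j₀ : ℕ := max σ₀ r₀ with hj₀_def
  have hj₀σ : σ₀ ≤ j₀ := le_max_left _ _
  have hj₀r : r₀ ≤ j₀ := le_max_right _ _
  have hpow_gt : ∀ m : ℕ, m < K ^ m := fun m => Nat.lt_pow_self hK1
  have hUm : ∀ m, j₀ ≤ m → critTwoArmProb (2 * K ^ m) (K ^ (m + 1)) ≤ U := by
    intro m hm
    have hρ : σ₀ ≤ K ^ m := by have := hpow_gt m; omega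
    have := hσ₀ (K ^ m) hρ
    rw [mul_comm (K ^ m) 2, ← pow_succ] at this
    exact this.le
  have hchain := upper_chain hK2 hU0.le hUm
  -- Step 4: the affine ratio `a' (d + 1) / (d + j₀ + 2) → a' < a`
  have h6 : ∀ᶠ d : ℕ in atTop, (a' * d + a') / (1 * d + ((j₀ : ℝ) + 2)) < a := by
    have h := tendsto_affine_div_affine a' a' 1 ((j₀ : ℝ) + 2) one_ne_zero
    rw [div_one] at h
    exact h.eventually_lt_const ha'2
  obtain ⟨d₀, hd₀⟩ := eventually_atTop.1 h6
  -- Step 5: sandwich `K^n ≤ N < K^{n+1}` and conclude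
  filter_upwards [eventually_ge_atTop (K ^ (j₀ + 1 + d₀))] with N hN
  have hKpowpos : 0 < K ^ (j₀ + 1 + d₀) := pow_pos (by omega) _
  have hNpos : N ≠ 0 := by omega
  set n := Nat.log K N with hn_def
  have hn_ge : j₀ + 1 + d₀ ≤ n := Nat.le_log_of_pow_le hK1 hN
  have hKn_le : K ^ n ≤ N := Nat.pow_log_le_self K hNpos
  have hN_lt : N < K ^ (n + 1) := Nat.lt_pow_succ_log_self hK1 N
  obtain ⟨d, hd⟩ : ∃ d, n = j₀ + 1 + d := ⟨n - (j₀ + 1), by omega⟩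
  have hd₀d : d₀ ≤ d := by omega
  have hr₀Kn : r₀ ≤ K ^ n := by have := hpow_gt n; omega
  obtain ⟨n₂, hn₂⟩ : ∃ n₂, n₂ + 1 = 2 * K ^ j₀ :=
    ⟨2 * K ^ j₀ - 1, by have := hpow_gt j₀; omega⟩
  have hb1 : critTwoArmProb r₀ N ≤ critTwoArmProb r₀ (K ^ n) := polyArmProb_anti_holds ![true, false] hr₀Kn hKn_le
  have hb2 : critTwoArmProb r₀ (K ^ n) ≤ critTwoArmProb r₀ n₂ * critTwoArmProb (2 * K ^ j₀) (K ^ n) := by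
    have h12 : r₀ ≤ n₂ := by have := hpow_gt j₀; omega
    have h23 : n₂ < K ^ n := by
      have : 2 * K ^ j₀ ≤ K ^ n := by
        calc 2 * K ^ j₀ ≤ K * K ^ j₀ := Nat.mul_le_mul_right _ hK2
          _ = K ^ (j₀ + 1) := by rw [pow_succ, mul_comm]
          _ ≤ K ^ n := Nat.pow_le_pow_right (by omega) (by omega)
      omega
    have := polyArmProb_submult ![true, false] h12 h23
    rwa [hn₂] at this
  have hb3 : critTwoArmProb (2 * K ^ j₀) (K ^ n) ≤ U ^ (d + 1) := hchain d j₀ n le_rfl hd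
  have hbU' : critTwoArmProb r₀ N ≤ U ^ (d + 1) := by
    calc critTwoArmProb r₀ N ≤ critTwoArmProb r₀ (K ^ n) := hb1
      _ ≤ critTwoArmProb r₀ n₂ * critTwoArmProb (2 * K ^ j₀) (K ^ n) := hb2
      _ ≤ 1 * U ^ (d + 1) :=
          mul_le_mul (polyArmProb_le_one _ _ _) hb3 (polyArmProb_nonneg _ _ _) zero_le_one
      _ = U ^ (d + 1) := one_mul _
  have hpos : 0 < critTwoArmProb r₀ N := polyArmProb_twoArm_pos hr₀ (by omega)
  have hlog_le : Real.log (critTwoArmProb r₀ N) ≤ ((d + 1 : ℕ) : ℝ) * (a' * Real.log K) := by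
    have := Real.log_le_log hpos hbU'
    rwa [Real.log_pow, hlogU] at this
  -- `log N`
  have h2N : (1 : ℝ) < N := by
    have : K ≤ K ^ (j₀ + 1 + d₀) := Nat.le_self_pow (by omega) K
    exact_mod_cast (show 2 ≤ N by omega)
  have hlogN_pos : 0 < Real.log (N : ℝ) := Real.log_pos h2N
  have hlogN_lt : Real.log (N : ℝ) < ((n + 1 : ℕ) : ℝ) * Real.log K := by
    have h : (N : ℝ) < (K : ℝ) ^ (n + 1) := by exact_mod_cast hN_lt
    have := Real.log_lt_log (by positivity) h
    rwa [Real.log_pow] at this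
  have hT_nonpos : ((d + 1 : ℕ) : ℝ) * (a' * Real.log K) ≤ 0 :=
    mul_nonpos_of_nonneg_of_nonpos (Nat.cast_nonneg _) (mul_neg_of_neg_of_pos ha'0 hlogKpos).le
  have hnlogK_pos : 0 < ((n + 1 : ℕ) : ℝ) * Real.log K := by positivity
  calc Real.log (critTwoArmProb r₀ N) / Real.log N
      ≤ ((d + 1 : ℕ) : ℝ) * (a' * Real.log K) / Real.log N :=
        div_le_div_of_nonneg_right hlog_le hlogN_pos.le
    _ ≤ ((d + 1 : ℕ) : ℝ) * (a' * Real.log K) / (((n + 1 : ℕ) : ℝ) * Real.log K) :=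
        div_le_div_of_nonpos_left' hT_nonpos hlogN_pos hlogN_lt.le
    _ = (a' * d + a') / (1 * d + ((j₀ : ℝ) + 2)) := by
        rw [hd]; push_cast; field_simp; ring
    _ < a := hd₀ d hd₀d

/-- Lower half of the exponent: from (A), (B), (D), (E), for every `a < -1/4` eventually
`a < log b(r₀, N) / log N` (Smirnov–Werner 2001, p. 5, lower product bound, with the sandwich
`K^n ≤ N < K^{n+1}`). [cite: SmirnovWernerMRL2001, §3 proof of Thm. 3 (p. 5) and §4] -/
theorem lower_part (b' : ℝ → ℝ)
    (hlim : ∀ r R : ℕ, 1 ≤ r → r < R →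
      Tendsto (fun ρ : ℕ => critTwoArmProb (ρ * r) (ρ * R)) atTop (𝓝 (b' ((R : ℝ) / r))))
    (hexp : Tendsto (fun l : ℝ => Real.log (b' l) / Real.log l) atTop (𝓝 (-(1 / 4))))
    {c : ℝ} (hc : 0 < c) {n₀ : ℕ}
    (hqm : ∀ n₁ n₂ n₃ : ℕ, n₀ ≤ n₁ → n₁ < n₂ → n₂ < n₃ → c * (critTwoArmProb n₁ n₂ * critTwoArmProb n₂ n₃) ≤ critTwoArmProb n₁ n₃)
    {r₀ : ℕ} (hr₀ : 1 ≤ r₀) (hr₀' : n₀ ≤ r₀) {a : ℝ} (ha : a < -(1 / 4)) :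
    ∀ᶠ N : ℕ in atTop, a < Real.log (critTwoArmProb r₀ N) / Real.log N := by
  -- an intermediate exponent `a < a' < -1/4`
  set a' : ℝ := (a + -(1 / 4)) / 2 with ha'_def
  have ha'1 : a < a' := by rw [ha'_def]; linarith
  have ha'2 : a' < -(1 / 4) := by rw [ha'_def]; linarith
  have ha'0 : a' < 0 := by linarith
  -- Step 1: the ratio `K`
  have h1 : Tendsto (fun K : ℕ => Real.log (b' K) / Real.log (K : ℝ)) atTop (𝓝 (-(1 / 4))) :=
    hexp.comp tendsto_natCast_atTop_atTop
  have hlogK : Tendsto (fun K : ℕ => Real.log (K : ℝ)) atTop atTop :=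
    Real.tendsto_log_atTop.comp tendsto_natCast_atTop_atTop
  have h2 : Tendsto (fun K : ℕ => a' + Real.log c / Real.log (K : ℝ)) atTop (𝓝 a') := by
    simpa using tendsto_const_nhds.add (tendsto_const_nhds.div_atTop hlogK)
  obtain ⟨K, ⟨⟨hKa, hKb⟩, hKc⟩, hK3⟩ :=
    ((((h1.eventually_const_lt ha'2).and
      (h1.eventually_lt_const (by norm_num : (-(1 / 4) : ℝ) < 0))).and
      (h2.eventually_const_lt ha'1)).and (eventually_ge_atTop 3)).exists
  have hK2 : 2 ≤ K := by omega
  have hK1 : 1 < K := by omega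
  have hKR : (3 : ℝ) ≤ K := by exact_mod_cast hK3
  have hlogKpos : 0 < Real.log (K : ℝ) := Real.log_pos (by linarith)
  have hKa' : a' * Real.log K < Real.log (b' K) := (lt_div_iff₀ hlogKpos).1 hKa
  have hKb' : Real.log (b' K) < 0 := by
    have := (div_lt_iff₀ hlogKpos).1 hKb
    rwa [zero_mul] at this
  -- `b'(K) > 0`
  have hlimK : Tendsto (fun ρ : ℕ => critTwoArmProb ρ (ρ * K)) atTop (𝓝 (b' K)) := by
    simpa using hlim 1 K le_rfl hK1
  have hb'0 : 0 ≤ b' K := ge_of_tendsto' hlimK fun ρ => polyArmProb_nonneg _ _ _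
  have hb'pos : 0 < b' K := by
    rcases hb'0.lt_or_eq with h | h
    · exact h
    · exfalso
      rw [← h, Real.log_zero] at hKb'
      exact lt_irrefl _ hKb'
  -- the per-scale bound `L = K^{a'}`
  set L : ℝ := Real.exp (a' * Real.log K) with hL_def
  have hL0 : 0 < L := Real.exp_pos _
  have hlogL : Real.log L = a' * Real.log K := Real.log_exp _
  have hLb : L < b' K := by
    rw [← Real.log_lt_log_iff hL0 hb'pos, hlogL]
    exact hKa'
  -- Step 2: the scale beyond which `L < b(σ, Kσ)`
  obtain ⟨σ₀, hσ₀⟩ := eventually_atTop.1 (hlimK.eventually_const_lt hLb)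
  set j₀ : ℕ := max σ₀ r₀ with hj₀_def
  have hj₀σ : σ₀ ≤ j₀ := le_max_left _ _
  have hj₀r : r₀ ≤ j₀ := le_max_right _ _
  have hpow_gt : ∀ m : ℕ, m < K ^ m := fun m => Nat.lt_pow_self hK1
  have hn₀K : ∀ m, j₀ ≤ m → n₀ ≤ K ^ m := fun m hm => by have := hpow_gt m; omega
  have hLm : ∀ m, j₀ ≤ m → L ≤ critTwoArmProb (K ^ m) (K ^ (m + 1)) := by
    intro m hm
    have := hσ₀ (K ^ m) (by have := hpow_gt m; omega)
    rw [← pow_succ] at this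
    exact this.le
  have hchain := lower_chain hc.le hqm hK2 hn₀K hL0.le hLm
  -- Step 3: the constant of the first annulus and the affine ratio
  set P : ℝ := c * critTwoArmProb r₀ (K ^ j₀) with hP_def
  have hP : 0 < P := mul_pos hc (polyArmProb_twoArm_pos hr₀ (by have := hpow_gt j₀; omega))
  have h6 : ∀ᶠ d : ℕ in atTop,
      a < ((Real.log c + a' * Real.log K) * d + (Real.log P + a' * Real.log K)) /
        (Real.log K * d + j₀ * Real.log K) := by
    have h := tendsto_affine_div_affine (Real.log c + a' * Real.log K)
      (Real.log P + a' * Real.log K) (Real.log K) (j₀ * Real.log K) hlogKpos.ne'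
    have heq : (Real.log c + a' * Real.log K) / Real.log K = a' + Real.log c / Real.log K := by
      field_simp
      ring
    rw [heq] at h
    exact h.eventually_const_lt hKc
  obtain ⟨d₀, hd₀⟩ := eventually_atTop.1 h6
  -- Step 4: sandwich `K^n ≤ N < K^{n+1}` and conclude
  filter_upwards [eventually_ge_atTop (K ^ (j₀ + 1 + d₀))] with N hN
  have hKpowpos : 0 < K ^ (j₀ + 1 + d₀) := pow_pos (by omega) _
  have hNpos : N ≠ 0 := by omega
  set n := Nat.log K N with hn_def
  have hn_ge : j₀ + 1 + d₀ ≤ n := Nat.le_log_of_pow_le hK1 hN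
  have hKn_le : K ^ n ≤ N := Nat.pow_log_le_self K hNpos
  have hN_lt : N < K ^ (n + 1) := Nat.lt_pow_succ_log_self hK1 N
  obtain ⟨d, hd⟩ : ∃ d, n = j₀ + d := ⟨n - j₀, by omega⟩
  have hd₀d : d₀ ≤ d := by omega
  have hb3 : c ^ d * L ^ (d + 1) ≤ critTwoArmProb (K ^ j₀) (K ^ (n + 1)) :=
    hchain d j₀ (n + 1) le_rfl (by omega)
  have hr₀N : r₀ ≤ N := by have := hpow_gt n; omega
  have hb1 : critTwoArmProb r₀ (K ^ (n + 1)) ≤ critTwoArmProb r₀ N := polyArmProb_anti_holds ![true, false] hr₀N hN_lt.le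
  have hb2 : c * (critTwoArmProb r₀ (K ^ j₀) * critTwoArmProb (K ^ j₀) (K ^ (n + 1))) ≤ critTwoArmProb r₀ (K ^ (n + 1)) :=
    hqm _ _ _ hr₀' (by have := hpow_gt j₀; omega) (Nat.pow_lt_pow_right hK1 (by omega))
  have hV : P * (c ^ d * L ^ (d + 1)) ≤ critTwoArmProb r₀ N := by
    calc P * (c ^ d * L ^ (d + 1)) ≤ P * critTwoArmProb (K ^ j₀) (K ^ (n + 1)) :=
          mul_le_mul_of_nonneg_left hb3 hP.le
      _ = c * (critTwoArmProb r₀ (K ^ j₀) * critTwoArmProb (K ^ j₀) (K ^ (n + 1))) := by rw [hP_def]; ring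
      _ ≤ critTwoArmProb r₀ N := hb2.trans hb1
  have hcdL : 0 < c ^ d * L ^ (d + 1) := mul_pos (pow_pos hc _) (pow_pos hL0 _)
  have hVpos : 0 < P * (c ^ d * L ^ (d + 1)) := mul_pos hP hcdL
  have hlogV : Real.log (P * (c ^ d * L ^ (d + 1))) =
      Real.log P + d * Real.log c + ((d + 1 : ℕ) : ℝ) * (a' * Real.log K) := by
    rw [Real.log_mul hP.ne' hcdL.ne', Real.log_mul (pow_pos hc _).ne' (pow_pos hL0 _).ne',
      Real.log_pow, Real.log_pow, hlogL]
    ring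
  have hlog_ge : Real.log P + d * Real.log c + ((d + 1 : ℕ) : ℝ) * (a' * Real.log K) ≤
      Real.log (critTwoArmProb r₀ N) := by
    rw [← hlogV]
    exact Real.log_le_log hVpos hV
  -- `log N`
  have h2N : (1 : ℝ) < N := by
    have : K ≤ K ^ (j₀ + 1 + d₀) := Nat.le_self_pow (by omega) K
    exact_mod_cast (show 2 ≤ N by omega)
  have hlogN_pos : 0 < Real.log (N : ℝ) := Real.log_pos h2N
  have hlogN_ge : (n : ℝ) * Real.log K ≤ Real.log (N : ℝ) := by
    have h : (K : ℝ) ^ n ≤ (N : ℝ) := by exact_mod_cast hKn_le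
    have := Real.log_le_log (by positivity) h
    rwa [Real.log_pow] at this
  have hnpos : 0 < n := by omega
  have hnlogK_pos : 0 < (n : ℝ) * Real.log K := mul_pos (by exact_mod_cast hnpos) hlogKpos
  set T := Real.log P + d * Real.log c + ((d + 1 : ℕ) : ℝ) * (a' * Real.log K) with hT_def
  rcases le_or_gt 0 T with hT | hT
  · -- `T ≥ 0`: the ratio is nonnegative, hence above `a < 0`
    have : 0 ≤ Real.log (critTwoArmProb r₀ N) / Real.log N := div_nonneg (hT.trans hlog_ge) hlogN_pos.le
    linarith
  · calc a < ((Real.log c + a' * Real.log K) * d + (Real.log P + a' * Real.log K)) /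
          (Real.log K * d + j₀ * Real.log K) := hd₀ d hd₀d
      _ = T / ((n : ℝ) * Real.log K) := by
          rw [hT_def, hd]; push_cast; ring
      _ ≤ T / Real.log N := div_le_div_of_nonpos_left' hT.le hnlogK_pos hlogN_ge
      _ ≤ Real.log (critTwoArmProb r₀ N) / Real.log N := div_le_div_of_nonneg_right hlog_ge hlogN_pos.le

end TwoArmAssembly

/-- **Assembly of the two-arm exponent** (Smirnov–Werner 2001, Thm. 4 for `j = 2`, from the two
observations of §4 by the argument printed on p. 5 for Thm. 3): the scaling limit with its `SLE₆`
exponent (A), quasi-multiplicativity (B), sub-multiplicativity (C), monotonicity in the outer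
radius (D) and positivity (E) imply `twoArm_exponent`, with threshold `r₁ = max n₀ 1` (`n₀` the
threshold of (B)). [cite: SmirnovWernerMRL2001, Thm. 4 (j = 2) and p. 5] [cite: Nolin2008, Thm. 21 (proof sketch) (arXiv 0711.4948: Thm. 20)] -/
theorem twoArm_exponent_of_facts (hA : SmirnovWerner2001_twoArm_scalingLimit)
    (hB : Nolin2008_twoArm_quasiMult) : twoArm_exponent := by
  obtain ⟨b', hlim, hexp⟩ := hA
  obtain ⟨c, hc, n₀, hqm⟩ := hB
  refine ⟨max n₀ 1, fun r₀ hr₀ => ?_⟩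
  have hr₀n : n₀ ≤ r₀ := le_trans (le_max_left _ _) hr₀
  have hr₀1 : 1 ≤ r₀ := le_trans (le_max_right _ _) hr₀
  unfold HasArmExponent HasDecayExponent
  rw [tendsto_order]
  refine ⟨fun a ha => TwoArmAssembly.lower_part b' hlim hexp hc hqm hr₀1 hr₀n ha,
    fun a ha => ?_⟩
  have ha₁ : (-(1 / 4) : ℝ) < min a (-(1 / 8)) := lt_min ha (by norm_num)
  have ha₁0 : min a (-(1 / 8)) < 0 := lt_of_le_of_lt (min_le_right _ _) (by norm_num)
  exact (TwoArmAssembly.upper_part b' hlim hexp hr₀1 ha₁ ha₁0).mono fun N hN =>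
    hN.trans_le (min_le_left _ _)

end Literature.Probability.Percolation
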